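import Mathlib
import Literature.Analysis.FluidPDE.LoopCirculation
import Summits.NavierStokesRegularity.NavierStokesRegularity.Theorems.TautLoopKelvinTautLoopLawStepWeberTools
import Summits.NavierStokesRegularity.NavierStokesRegularity.Theorems.TautLoopKelvinTautLoopLawStepSixPointTools
import HarnessLib

/-!
# Route `TautLoopKelvin`, crux `TautLoopLaw` (stmt-NavierStokesRegularity-15249), line
  `Sketch-ideas-r1k1` (Dini–Saks architecture) — tools stub `stub_tautLoopStepSchemeCircTools`

**Circulation of the `n`-step scheme field as an average over `6ⁿ` deformed loops.**
The scheme of the random-walk selection is `θ_{k+1} = (DA_k)† ((M_a θ_k) ∘ A_k)`, where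
`M_a f(x) = ⅙ Σ_{i<3} (f(x + a eᵢ) + f(x − a eᵢ))` is the six-point coordinate average and `A_k` a
`C¹` map of `ℝ³`.  A path `p : Fin n → Fin 6` encodes at step `k` the signed coordinate vector
`y(p k) = (±a) e_{(p k)/2}` (sign `+` iff `p k` is even), and the recursively deformed loops are
`L^p_n = γ`, `L^p_k = A_k ∘ L^p_{k+1} + y(p k)`.  Then every `L^p_k` is a closed `C¹` loop and

  `∮_γ θ_n · dℓ = 6⁻ⁿ Σ_p ∮_{L^p_0} θ_0 · dℓ`.

Proof: induction on `n`, peeling the last scheme step with the Weber pull-back identity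
`∮_γ (DA)† (f ∘ A) = ∮_{A ∘ γ} f` (`…StepWeberTools`) and the six-point circulation average
(`…StepSixPointTools`), the six translates `A_n ∘ γ ± a eᵢ` being exactly the loops
`A_n ∘ γ + y(c)`, `c ∈ Fin 6`; the paths are reindexed by `Fin.snocEquiv`.  Everything is
folklore (Majda–Bertozzi, *Vorticity and Incompressible Flow*, §1.6).
-/

noncomputable section

open Function Literature.Analysis.FluidPDE
open ContinuousLinearMap (adjoint)
open scoped InnerProductSpace RealInnerProductSpace

namespace Summit.NavierStokesRegularity.NavierStokesRegularity.Theorems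

set_option linter.dupNamespace false

local notation3 "E3" => EuclideanSpace ℝ (Fin 3)

local notation3 "𝐞[" i "]" => (EuclideanSpace.single (i : Fin 3) (1:ℝ) : EuclideanSpace ℝ (Fin 3))

/-! ## Bookkeeping of the six colours and of the paths -/

/-- The six signed coordinate steps `y(c) = (±a) e_{c/2}` (sign `+` iff `c` is even) are
`a e₀, −a e₀, a e₁, −a e₁, a e₂, −a e₂`: a sum over the six colours is the sum over the three
coordinates of the `±` pair. [folklore] -/
theorem tautLoopScheme_sum_six {M : Type*} [AddCommMonoid M] (G : E3 → M) (a : ℝ) :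
    ∑ c : Fin 6, G ((if ((c : Fin 6) : ℕ) % 2 = 0 then a else -a) •
      EuclideanSpace.single (⟨((c : Fin 6) : ℕ) / 2, by omega⟩ : Fin 3) (1:ℝ)) =
      ∑ i : Fin 3, (G (a • 𝐞[i]) + G ((-a) • 𝐞[i])) := by
  have h2 : (⟨2, by norm_num⟩ : Fin 3) = 2 := rfl
  simp only [Fin.sum_univ_six, Fin.sum_univ_three, add_assoc]
  norm_num [h2]

/-- Splitting off the last step of a path: `Σ_{p : Fin (n+1) → Fin 6} G p =
Σ_{c} Σ_{p' : Fin n → Fin 6} G (snoc p' c)` (`Fin.snocEquiv`). [folklore] -/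
theorem tautLoopScheme_sum_snoc {M : Type*} [AddCommMonoid M] {n : ℕ}
    (G : (Fin (n + 1) → Fin 6) → M) :
    ∑ p : Fin (n + 1) → Fin 6, G p = ∑ c : Fin 6, ∑ p : Fin n → Fin 6, G (Fin.snoc p c) := by
  rw [← (Fin.snocEquiv fun _ : Fin (n + 1) => Fin 6).sum_comp, Fintype.sum_prod_type]
  rfl

/-! ## One scheme step -/

/-- **One step of the scheme on the loop side.** For a `C¹` map `A`, a continuous field `f` and a
closed `C¹` loop `L`, the circulation of `(DA)† ((M_a f) ∘ A)` around `L` is the average over the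
six colours `c` of the circulations of `f` around the translated image loops `A ∘ L + y(c)`
(Weber pull-back identity, then the six-point circulation average). [folklore] -/
theorem tautLoopScheme_circulation_step (A f : E3 → E3) (a : ℝ) (L : ℝ → E3)
    (hA : ContDiff ℝ 1 A) (hf : Continuous f) (hL : IsC1Loop L) :
    circulation (fun x => adjoint (fderiv ℝ A x)
      ((1 / 6 : ℝ) • (∑ i : Fin 3, (f (A x + a • 𝐞[i]) + f (A x - a • 𝐞[i]))))) L =
      (1 / 6 : ℝ) * ∑ c : Fin 6, circulation f (fun s => A (L s) +
        (if ((c : Fin 6) : ℕ) % 2 = 0 then a else -a) •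
          EuclideanSpace.single (⟨((c : Fin 6) : ℕ) / 2, by omega⟩ : Fin 3) (1:ℝ)) := by
  have hW := tautLoopWeber_circulation_comp_of_isC1Loop
    (fun z => (1 / 6 : ℝ) • (∑ i : Fin 3, (f (z + a • 𝐞[i]) + f (z - a • 𝐞[i])))) hA hL
  have h6 := tautLoopScheme_sum_six (fun v => circulation f (fun s => A (L s) + v)) a
  simp only [neg_smul, ← sub_eq_add_neg] at h6
  rw [← hW, h6]
  exact tautLoopSix_circulation_average f a (A ∘ L) hf (tautLoopWeber_isC1Loop_comp hA hL)

/-! ## The tools stub -/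

/-- **Tools stub `stub_tautLoopStepSchemeCircTools`** (registered signature, verbatim): for the
scheme `θ_{k+1} = (DA_k)† ((M_astep θ_k) ∘ A_k)` with `C¹` maps `A_k` and continuous fields `θ_k`,
a closed `C¹` loop `γ` and the recursively deformed loops `L^p_n = γ`,
`L^p_k = A_k ∘ L^p_{k+1} + y(p k)` indexed by the paths `p : Fin n → Fin 6`, every `L^p_k`
(`k ≤ n`) is a closed `C¹` loop and `∮_γ θ_n = 6⁻ⁿ Σ_p ∮_{L^p_0} θ_0` (induction on `n`, peeling
the last step with `tautLoopScheme_circulation_step` and reindexing the paths by `Fin.snoc`).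
[folklore] -/
theorem stub_tautLoopStepSchemeCircTools : ∀ (n : ℕ) (astep : ℝ) (A : ℕ → EuclideanSpace ℝ
    (Fin 3) → EuclideanSpace ℝ (Fin 3)) (θ : ℕ → EuclideanSpace ℝ (Fin 3) → EuclideanSpace ℝ
    (Fin 3)) (γ : ℝ → EuclideanSpace ℝ (Fin 3)) (Lp : (Fin n → Fin 6) → ℕ → ℝ → EuclideanSpace ℝ
    (Fin 3)), (∀ k, k < n → ContDiff ℝ 1 (A k)) → (∀ k, k ≤ n → Continuous (θ k)) →
    Literature.Analysis.FluidPDE.IsC1Loop γ → (∀ k, k < n → ∀ x, θ (k + 1) x =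
    ContinuousLinearMap.adjoint (fderiv ℝ (A k) x) ((1 / 6 : ℝ) • (∑ i : Fin 3, (θ k (A k x +
    astep • EuclideanSpace.single i (1:ℝ)) + θ k (A k x - astep • EuclideanSpace.single i
    (1:ℝ)))))) → (∀ p, Lp p n = γ) → (∀ p, ∀ k : ℕ, ∀ hk : k < n, ∀ σ, Lp p k σ = A k (Lp p (k +
    1) σ) + (if ((p ⟨k, hk⟩ : Fin 6) : ℕ) % 2 = 0 then astep else -astep) • EuclideanSpace.single
    (⟨((p ⟨k, hk⟩ : Fin 6) : ℕ) / 2, by omega⟩ : Fin 3) (1:ℝ)) → (∀ p, ∀ k, k ≤ n →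
    Literature.Analysis.FluidPDE.IsC1Loop (Lp p k)) ∧ Literature.Analysis.FluidPDE.circulation
    (θ n) γ = (1 / 6 : ℝ) ^ n * ∑ p : Fin n → Fin 6, Literature.Analysis.FluidPDE.circulation
    (θ 0) (Lp p 0) := by
  intro n
  induction n with
  | zero =>
    intro astep A θ γ Lp _hA _hθ hγ _hrec hLn _hLrec
    refine ⟨fun p k hk => ?_, ?_⟩
    · obtain rfl : k = 0 := Nat.le_zero.mp hk
      rw [hLn p]
      exact hγ
    · simp [hLn]
  | succ n ih =>
    intro astep A θ γ Lp hA hθ hγ hrec hLn hLrec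
    have hn : n < n + 1 := lt_add_one n
    -- the six translated image loops `A_n ∘ γ + y(c)` are closed `C¹` loops
    have hLc : ∀ c : Fin 6, IsC1Loop (fun s => A n (γ s) +
        (if ((c : Fin 6) : ℕ) % 2 = 0 then astep else -astep) •
          EuclideanSpace.single (⟨((c : Fin 6) : ℕ) / 2, by omega⟩ : Fin 3) (1:ℝ)) :=
      fun c => (tautLoopWeber_isC1Loop_comp (hA n hn) hγ).add_const _
    -- the induction hypothesis for the paths ending with the colour `c`
    have key : ∀ c : Fin 6, (∀ p' : Fin n → Fin 6, ∀ k, k ≤ n →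
        IsC1Loop (Lp (Fin.snoc p' c) k)) ∧ circulation (θ n) (fun s => A n (γ s) +
        (if ((c : Fin 6) : ℕ) % 2 = 0 then astep else -astep) •
          EuclideanSpace.single (⟨((c : Fin 6) : ℕ) / 2, by omega⟩ : Fin 3) (1:ℝ)) =
        (1 / 6 : ℝ) ^ n * ∑ p' : Fin n → Fin 6, circulation (θ 0) (Lp (Fin.snoc p' c) 0) := by
      intro c
      refine ih astep A θ _ (fun p' => Lp (Fin.snoc p' c)) (fun k hk => hA k (by omega))
        (fun k hk => hθ k (by omega)) (hLc c) (fun k hk x => hrec k (by omega) x) ?_ ?_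
      · intro p'
        funext σ
        have hl : (Fin.snoc p' c : Fin (n + 1) → Fin 6) ⟨n, hn⟩ = c :=
          Fin.snoc_last (α := fun _ => Fin 6) c p'
        rw [hLrec (Fin.snoc p' c) n hn σ, hLn]
        simp only [hl]
      · intro p' k hk σ
        have hk' : k < n + 1 := by omega
        have hc : (Fin.snoc p' c : Fin (n + 1) → Fin 6) ⟨k, hk'⟩ = p' ⟨k, hk⟩ :=
          Fin.snoc_castSucc (α := fun _ => Fin 6) c p' ⟨k, hk⟩
        rw [hLrec (Fin.snoc p' c) k hk' σ]
        simp only [hc]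
    refine ⟨fun p k hk => ?_, ?_⟩
    · rcases Nat.lt_or_ge k (n + 1) with h | h
      · have h1 := (key (p (Fin.last n))).1 (Fin.init p) k (by omega)
        rwa [Fin.snoc_init_self] at h1
      · obtain rfl : k = n + 1 := le_antisymm hk h
        rw [hLn p]
        exact hγ
    · have hfun : θ (n + 1) = fun x => adjoint (fderiv ℝ (A n) x) ((1 / 6 : ℝ) •
          (∑ i : Fin 3, (θ n (A n x + astep • 𝐞[i]) + θ n (A n x - astep • 𝐞[i])))) :=
        funext (hrec n hn)
      rw [hfun, tautLoopScheme_circulation_step (A n) (θ n) astep γ (hA n hn) (hθ n (by omega))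
        hγ, Finset.sum_congr rfl fun c _ => (key c).2, tautLoopScheme_sum_snoc,
        ← Finset.mul_sum]
      ring
end Summit.NavierStokesRegularity.NavierStokesRegularity.Theorems

end
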